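import Summits.NavierStokesRegularity.NavierStokesRegularity.Theorems.BoundedTemperatureClosed.Negative.ZeroDatumTools

/-!
# Crux `BoundedTemperatureClosed` (stmt-NavierStokesRegularity-18303), negative side:
# restatement bite table, II — dropping the Type-I ceiling reverses the sign (line lead c2)

Companion of `CollinearBites.lean`. A tempting repair of the over-quantified crux is to DROP the Type-I
ceiling and ask that, for every symmetric cancelling averaging datum `𝒜`, the set of `θ ∈ [0,1]` at which the
segment form `T_θ = (1-θ)·B̃_𝒜 + θ·B` has a Schwartz-data `H¹⁰_df`-mild solution with NO mild extension is
closed (`typeIFreeClosed`, a local notation below). Kernel-checked here: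

* `mem_btSetFree_iff_of_form_eq_zero`, `zero_not_mem_btSetFree_of_form_eq_zero` — at a form-zero datum the
  rate-free set is `{θ ∈ (0,1] | nsMild}` where `nsMild` = "Navier–Stokes has a Schwartz-data `H¹⁰_df`-mild
  solution with no mild extension" (amplitude scaling `mildNoExtension_smul`; the heat point never blows up,
  by the `H¹⁰` continuation criterion valid for every averaging datum).
* `not_nsMild_of_typeIFreeClosed` — **Bite 2a**: `typeIFreeClosed → ¬ nsMild` (the set `(0,1]` would have to
  contain `0`).
* `nsMild_of_typeIFreeClosed_of_door` — **Bite 2b**: `typeIFreeClosed → EulerProximatePump → nsMild` (the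
  Door's members are rate-free members accumulating at `1`; at `θ = 1` the segment form is `B`).
* `not_eulerProximatePump_of_typeIFreeClosed` — hence **the Type-I-free Link contradicts the Door**: filing it
  would make the route's two cruxes jointly inconsistent. The consistent repair keeps the endpoint-only,
  Type-I-free CONCLUSION form `AtOne ≡ (EulerProximatePump → nsMild)` (`CollinearBites.linkAtOne_iff_door_imp`).

Statement shapes are local notations (no new definitions).

## References

* T. Tao, J. Amer. Math. Soc. 29 (2016), arXiv:1402.0290v3, §1.1 (1.13), (1.15). [`Tao2016AveragedNS`]
-/

noncomputable section

-- the nested summit namespace `…NavierStokesRegularity.NavierStokesRegularity…` is the tree's layout (D-0017)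
set_option linter.dupNamespace false

namespace Summit.NavierStokesRegularity.NavierStokesRegularity.Theorems.BoundedTemperatureClosed.Negative

open MeasureTheory Set Filter Topology
open scoped ENNReal
open Literature.Analysis.FluidPDE Literature.Analysis.FluidPDE.Tao2016

/-- **Navier–Stokes has a Schwartz-data `H¹⁰_df`-mild solution with no mild extension** (no rate) — the
hypothesis shape of the route's proved bridge `MildBlowupClassical`. -/
local notation3 "nsMild" =>
  ∃ u₀ : SchwartzMap (EuclideanSpace ℝ (Fin 3)) (EuclideanSpace ℝ (Fin 3)),
    Literature.Analysis.FluidPDE.VectorCalculus.IsDivFree ⇑u₀ ∧ ∃ S : ℝ, 0 < S ∧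
    ∃ u : ℝ → Literature.Analysis.FluidPDE.Tao2016.L2C,
      Literature.Analysis.FluidPDE.Tao2016.IsMildSolutionFor
        Literature.Analysis.FluidPDE.Tao2016.eulerForm
        (Literature.Analysis.FluidPDE.Tao2016.schwartzL2 u₀) (Set.Ico 0 S) u ∧
      ¬ ∃ S' : ℝ, S < S' ∧ ∃ v : ℝ → Literature.Analysis.FluidPDE.Tao2016.L2C,
        Literature.Analysis.FluidPDE.Tao2016.IsMildSolutionFor
          Literature.Analysis.FluidPDE.Tao2016.eulerForm
          (Literature.Analysis.FluidPDE.Tao2016.schwartzL2 u₀) (Set.Ico 0 S') v ∧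
        ∀ t ∈ Set.Ico 0 S, v t = u t

/-! ### The rate-free blow-up set; amplitude scaling; the heat point -/

/-- The Type-I-free blow-up set of the datum `𝒜` along the segment: `θ ∈ [0,1]` at which `T_θ` has a
Schwartz-data `H¹⁰_df`-mild solution with NO mild extension (no rate). -/
local notation3 "btSetFree[" 𝒜 "]" =>
  {θ : ℝ | θ ∈ Set.Icc (0 : ℝ) 1 ∧
    ∃ u₀ : SchwartzMap (EuclideanSpace ℝ (Fin 3)) (EuclideanSpace ℝ (Fin 3)),
      Literature.Analysis.FluidPDE.VectorCalculus.IsDivFree ⇑u₀ ∧ ∃ S : ℝ, 0 < S ∧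
      ∃ u : ℝ → Literature.Analysis.FluidPDE.Tao2016.L2C,
        Literature.Analysis.FluidPDE.Tao2016.IsMildSolutionFor
          (fun a b c => ((1 - θ : ℝ) : ℂ) * AveragingDatum.form 𝒜 a b c +
            ((θ : ℝ) : ℂ) * Literature.Analysis.FluidPDE.Tao2016.eulerForm a b c)
          (Literature.Analysis.FluidPDE.Tao2016.schwartzL2 u₀) (Set.Ico 0 S) u ∧
        ¬ ∃ S' : ℝ, S < S' ∧ ∃ v : ℝ → Literature.Analysis.FluidPDE.Tao2016.L2C,
          Literature.Analysis.FluidPDE.Tao2016.IsMildSolutionFor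
            (fun a b c => ((1 - θ : ℝ) : ℂ) * AveragingDatum.form 𝒜 a b c +
              ((θ : ℝ) : ℂ) * Literature.Analysis.FluidPDE.Tao2016.eulerForm a b c)
            (Literature.Analysis.FluidPDE.Tao2016.schwartzL2 u₀) (Set.Ico 0 S') v ∧
          ∀ t ∈ Set.Ico 0 S, v t = u t}

open PumpContinuationEulerProximatePump (isMildSolutionFor_smul smul_inv_of_smul inv_smul_smul_ofReal) in
/-- **Amplitude scaling of a Schwartz-data mild solution with no extension (no rate).** For `c ≠ 0` and
`T'(c a, c b, w) = c · T(a, b, w)`, `u ↦ c u` carries a `T`-witness to a `T'`-witness (datum `c • u₀`; an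
extension of `c u` for `T'` would rescale by `c⁻¹` to one of `u` for `T`) — the rate-free part of the landed
`typeIBlowup_smul`. [cite: Tao2016AveragedNS, §1.1 (1.15)] -/
theorem mildNoExtension_smul (T T' : L2C → L2C → L2C → ℂ) {c : ℝ} (hc : c ≠ 0)
    (hT : ∀ a b w : L2C, T' (((c : ℝ) : ℂ) • a) (((c : ℝ) : ℂ) • b) w = ((c : ℝ) : ℂ) * T a b w)
    (h : ∃ u₀ : SchwartzMap (EuclideanSpace ℝ (Fin 3)) (EuclideanSpace ℝ (Fin 3)),
      VectorCalculus.IsDivFree ⇑u₀ ∧ ∃ S : ℝ, 0 < S ∧ ∃ u : ℝ → L2C,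
        IsMildSolutionFor T (schwartzL2 u₀) (Ico 0 S) u ∧
        ¬ ∃ S' : ℝ, S < S' ∧ ∃ v : ℝ → L2C,
            IsMildSolutionFor T (schwartzL2 u₀) (Ico 0 S') v ∧ ∀ t ∈ Ico 0 S, v t = u t) :
    ∃ u₀ : SchwartzMap (EuclideanSpace ℝ (Fin 3)) (EuclideanSpace ℝ (Fin 3)),
      VectorCalculus.IsDivFree ⇑u₀ ∧ ∃ S : ℝ, 0 < S ∧ ∃ u : ℝ → L2C,
        IsMildSolutionFor T' (schwartzL2 u₀) (Ico 0 S) u ∧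
        ¬ ∃ S' : ℝ, S < S' ∧ ∃ v : ℝ → L2C,
            IsMildSolutionFor T' (schwartzL2 u₀) (Ico 0 S') v ∧ ∀ t ∈ Ico 0 S, v t = u t := by
  obtain ⟨u₀, hdiv, S, hS, u, hu, hnoext⟩ := h
  refine ⟨c • u₀, PerpetualPumpEulerTypeIGlue.isDivFree_const_smul (u₀.smooth 1) hdiv c, S, hS,
    fun t => ((c : ℝ) : ℂ) • u t, ?_, ?_⟩
  · rw [schwartzL2_smul]
    exact isMildSolutionFor_smul T T' c hT _ _ _ hu
  · rintro ⟨S', hSS', v, hv, hvu⟩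
    refine hnoext ⟨S', hSS', fun t => ((c⁻¹ : ℝ) : ℂ) • v t, ?_, fun t ht => ?_⟩
    · have h2 := isMildSolutionFor_smul T' T c⁻¹ (smul_inv_of_smul T T' hc hT) _ _ _ hv
      rwa [schwartzL2_smul, inv_smul_smul_ofReal hc] at h2
    · show ((c⁻¹ : ℝ) : ℂ) • v t = u t
      rw [hvu t ht, inv_smul_smul_ofReal hc]

/-- **Type-I-free membership at a form-zero datum is "Navier–Stokes has a Schwartz-data mild blow-up"**:
for `0 < θ ≤ 1`, `θ ∈ btSetFree[𝒜] ↔ nsMild` (segment `θ·B`, amplitude scaling by `θ^{±1}`). [cite: Tao2016AveragedNS, §1.1 (1.15)] -/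
theorem mem_btSetFree_iff_of_form_eq_zero {𝒜 : AveragingDatum} (h0 : ∀ u v w : L2C, 𝒜.form u v w = 0)
    {θ : ℝ} (hθ : 0 < θ) (hθ1 : θ ≤ 1) : θ ∈ btSetFree[𝒜] ↔ nsMild := by
  have hdiag : ∀ a w : L2C, ((1 - θ : ℝ) : ℂ) * 𝒜.form a a w + ((θ : ℝ) : ℂ) * eulerForm a a w =
      ((θ : ℝ) : ℂ) * eulerForm a a w := fun a w => by
    rw [h0, mul_zero, zero_add]
  have hT1 : ∀ a b w : L2C, eulerForm (((θ : ℝ) : ℂ) • a) (((θ : ℝ) : ℂ) • b) w =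
      ((θ : ℝ) : ℂ) * (((θ : ℝ) : ℂ) * eulerForm a b w) := fun a b w => by
    rw [eulerForm_smul_smul]
    ring
  have hT2 : ∀ a b w : L2C, ((θ : ℝ) : ℂ) * eulerForm (((θ⁻¹ : ℝ) : ℂ) • a) (((θ⁻¹ : ℝ) : ℂ) • b) w =
      ((θ⁻¹ : ℝ) : ℂ) * eulerForm a b w := fun a b w => by
    have hθC : ((θ : ℝ) : ℂ) ≠ 0 := Complex.ofReal_ne_zero.2 hθ.ne'
    rw [eulerForm_smul_smul, Complex.ofReal_inv]
    field_simp
  simp only [mem_setOf_eq,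
    isMildSolutionFor_congr_diag
      (T := fun a b w => ((1 - θ : ℝ) : ℂ) * 𝒜.form a b w + ((θ : ℝ) : ℂ) * eulerForm a b w)
      (T' := fun a b w => ((θ : ℝ) : ℂ) * eulerForm a b w) hdiag]
  constructor
  · rintro ⟨-, hw⟩
    exact mildNoExtension_smul (fun a b w => ((θ : ℝ) : ℂ) * eulerForm a b w) eulerForm hθ.ne' hT1 hw
  · intro hw
    exact ⟨⟨hθ.le, hθ1⟩, mildNoExtension_smul eulerForm (fun a b w => ((θ : ℝ) : ℂ) * eulerForm a b w)
      (inv_ne_zero hθ.ne') hT2 hw⟩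

open PerpetualPumpThesis (stub_thesis_H10Continuation) in
open PerpetualPumpThesis.G (eq_of_forall_pairing_eq) in
/-- **The heat point is never a Type-I-free member either**: at `θ = 0` a form-zero datum drives the heat
equation, `u t = e^{tΔ}u(0)` stays `H¹⁰`-bounded, and the `H¹⁰` continuation criterion
(`stub_thesis_H10Continuation`, every averaging datum) extends it — the rate-free reading of the landed
`zero_not_mem_btSet_of_form_eq_zero`. [cite: Tao2016AveragedNS, §1.1 (1.15)] -/
theorem zero_not_mem_btSetFree_of_form_eq_zero {𝒜 : AveragingDatum} (h0 : ∀ u v w : L2C, 𝒜.form u v w = 0) :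
    (0 : ℝ) ∉ btSetFree[𝒜] := by
  have hdiag : ∀ a w : L2C, ((1 - (0 : ℝ) : ℝ) : ℂ) * 𝒜.form a a w + (((0 : ℝ) : ℝ) : ℂ) * eulerForm a a w =
      𝒜.form a a w := fun a w => by
    push_cast
    ring
  simp only [mem_setOf_eq,
    isMildSolutionFor_congr_diag
      (T := fun a b w => ((1 - (0 : ℝ) : ℝ) : ℂ) * 𝒜.form a b w + (((0 : ℝ) : ℝ) : ℂ) * eulerForm a b w)
      (T' := 𝒜.form) hdiag]
  rintro ⟨-, u₀, hdiv, S, hS, u, hu, hnoext⟩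
  apply hnoext
  have h0S : (0 : ℝ) ∈ Ico 0 S := ⟨le_rfl, hS⟩
  have hu0 : MemH10df (u 0) := hu.1 0 h0S
  have heq : ∀ t ∈ Ico 0 S, u t = heat t (u 0) := by
    intro t ht
    refine eq_of_forall_pairing_eq (hu.1 t ht) (hu0.heat t) fun w hw => ?_
    have h1 := hu.2.2 t ht w hw
    simp only [h0, intervalIntegral.integral_zero, add_zero] at h1
    rw [h1, pairing_heat_left, pairing_heat_left, hu.initial h0S (hw.heat t)]
  have hbd : ∃ C : ℝ, ∀ t ∈ Ico 0 S,
      Literature.Analysis.FunctionSpaces.eFourierSobolevNorm 10 (u t) ≤ ENNReal.ofReal C := by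
    refine ⟨(Literature.Analysis.FunctionSpaces.eFourierSobolevNorm 10 (u 0)).toReal, fun t ht => ?_⟩
    rw [ENNReal.ofReal_toReal hu0.1.ne, heq t ht]
    exact eFourierSobolevNorm_heat_le 10 t (u 0)
  exact stub_thesis_H10Continuation 𝒜 u₀ hdiv S hS u hu hbd

/-- **Bite 2a.** Type-I-free closedness for all symmetric cancelling data implies that Navier–Stokes has
NO Schwartz-data `H¹⁰_df`-mild blow-up: at the zero datum a blow-up would make the set `(0,1]`, accumulating
at the non-member heat point `0`. [cite: Tao2016AveragedNS, §1.1 (1.15)] -/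
theorem not_nsMild_of_typeIFreeClosed
    (hF : ∀ 𝒜 : AveragingDatum, 𝒜.IsSymmetric → 𝒜.HasCancellation → IsClosed btSetFree[𝒜]) : ¬ nsMild := by
  intro hns
  obtain ⟨𝒜, hs, hc, h0⟩ := exists_form_eq_zero
  have hsub : Ioc (0 : ℝ) 1 ⊆ btSetFree[𝒜] := fun θ hθ =>
    (mem_btSetFree_iff_of_form_eq_zero h0 hθ.1 hθ.2).2 hns
  have hmem : (0 : ℝ) ∈ btSetFree[𝒜] := by
    refine (hF 𝒜 hs hc).closure_subset_iff.2 hsub ?_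
    rw [closure_Ioc zero_ne_one]
    exact ⟨le_rfl, zero_le_one⟩
  exact zero_not_mem_btSetFree_of_form_eq_zero h0 hmem

/-- **Bite 2b.** Type-I-free closedness together with the Door implies that Navier–Stokes HAS a
Schwartz-data `H¹⁰_df`-mild blow-up: the Door's Type-I members are rate-free members accumulating at `1`,
closedness puts `1` in the rate-free set, and at `θ = 1` the segment form is `B`. [folklore] -/
theorem nsMild_of_typeIFreeClosed_of_door
    (hF : ∀ 𝒜 : AveragingDatum, 𝒜.IsSymmetric → 𝒜.HasCancellation → IsClosed btSetFree[𝒜])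
    (hD : Theses.PumpContinuation.EulerProximatePump) : nsMild := by
  obtain ⟨𝒜, hs, hc, M, hM⟩ := hD
  have h1 : (1 : ℝ) ∈ btSetFree[𝒜] := by
    rw [← (hF 𝒜 hs hc).closure_eq, Metric.mem_closure_iff]
    intro ε hε
    obtain ⟨θ, hθ1, hθ2, hθ0, u₀, hdiv, S, hS, u, hu, -, hno⟩ := hM ε hε
    refine ⟨θ, ⟨⟨hθ0, hθ2.le⟩, u₀, hdiv, S, hS, u, hu, hno⟩, ?_⟩
    rw [Real.dist_eq, abs_of_nonneg (by linarith)]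
    linarith
  have hform : (fun a b w => (((1 : ℝ) - 1 : ℝ) : ℂ) * 𝒜.form a b w + (((1 : ℝ) : ℝ) : ℂ) * eulerForm a b w) =
      eulerForm := by
    funext a b w
    push_cast
    ring
  simp only [mem_setOf_eq, hform] at h1
  exact h1.2

/-- **Bite 2: the Type-I-free `∀ 𝒜` Link contradicts the Door** (`2a` with `2b`). Filing it would make the
route's two cruxes jointly inconsistent; equivalently the Door REFUTES that restatement. [folklore] -/
theorem not_eulerProximatePump_of_typeIFreeClosed
    (hF : ∀ 𝒜 : AveragingDatum, 𝒜.IsSymmetric → 𝒜.HasCancellation → IsClosed btSetFree[𝒜]) :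
    ¬ Theses.PumpContinuation.EulerProximatePump := fun hD =>
  not_nsMild_of_typeIFreeClosed hF (nsMild_of_typeIFreeClosed_of_door hF hD)

end Summit.NavierStokesRegularity.NavierStokesRegularity.Theorems.BoundedTemperatureClosed.Negative

end
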